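import Literature.NumberTheory.Transcendental.NesterenkoUResultantIntegral
import Literature.NumberTheory.Transcendental.NesterenkoChowFormDistinct
import Mathlib.RingTheory.Ideal.GoingUp
import Mathlib.FieldTheory.IsAlgClosed.Basic
import Mathlib.Algebra.MvPolynomial.SchwartzZippel
import HarnessLib

/-!
# The `u`-resultant of the Chow form of a prime with a form: the product formula at EVERY point (towards LNM 1752 Ch. 3 Prop. 4.11 3))

`Literature/NumberTheory/Transcendental/NesterenkoUResultantPointwise.lean`. Sequel of
`NesterenkoUResultantIntegral.lean` (the `u`-resultant `G = uResultant 𝔭 s d Q₀ ∈ A = ℚ[u₁, …, u_s]`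
of a homogeneous prime `𝔭` of rank `s + 1` with an integer form `Q₀` of degree `d`;
`G = c^d ∏_{i<D} Q₀(β⁽ⁱ⁾)` in `Ω = ℚ(u₁, …, u_s)‾` for the splitting `F(u₁, …, u_s; w) = c ∏ (β⁽ⁱ⁾ · w)`
of the associated form over the generic linear section).

The specialisations of `NesterenkoUResultantSpecialize.lean` transport this identity to complex
points `z` at which `ℚ[u₁, …, u_s] → ℂ` is INJECTIVE. The value estimate 3) of Prop. 4.11 needs it
at the points `z = (S⁽¹⁾ω̄, …, S⁽ˢ⁾ω̄)` of the skew substitution `ϰ`, where injectivity FAILS for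
rational `ω̄` (`(S ω̄) · ω̄ = 0`). This file proves the product formula at EVERY point `u⁰ ∈ K^{s(m+1)}`
(`K` any algebraically closed field of characteristic `0`) at which the specialised form
`F(u⁰; ·)` is not identically zero:

* rational "charts" `v ∈ ℚ^{m+1}`: `a_v = F(u₁, …, u_s; v) ∈ A` (`aChart`), with
  `a_v = c ∏ᵢ (v · β⁽ⁱ⁾)` in `Ω` (`algebraMap_aChart`); if `a_v ≠ 0` the section points normalised
  by `v · β = 1` are `b⁽ⁱ⁾ = β⁽ⁱ⁾ / (v · β⁽ⁱ⁾)` (`bChart`), and **`a_v b⁽ⁱ⁾_k` is INTEGRAL over `A`**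
  (`isIntegral_aChart_mul_bChart`): `−b⁽ⁱ⁾_k` is a root of the line polynomial
  `T ↦ F(u₁, …, u_s; T v + e_k) ∈ A[T]`, whose leading coefficient is `a_v`
  (`Polynomial.isIntegral_leadingCoeff_smul`);
* the `A`-algebra `S = A[a_v b⁽ⁱ⁾_k] ⊂ Ω` (`HullU`) is integral over `A`, so by LYING OVER and
  `IsAlgClosed.lift` every evaluation `A → K` extends to `S → K` (`exists_specializationU`);
* **pointwise product formula** (`exists_pointwise_uResultant`): if `a_v(u⁰) ≠ 0` there are
  `γ⁽ⁱ⁾ ∈ K^{m+1}` (`i < D`) with `v · γ⁽ⁱ⁾ = 1`, zeros of `𝔭` on the hyperplanes `u⁰₁, …, u⁰_s`, such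
  that `F(u⁰; w) = a_v(u⁰) ∏ (γ⁽ⁱ⁾ · w)` in `K[w]` and `G(u⁰) = a_v(u⁰)^d ∏ Q₀(γ⁽ⁱ⁾)`;
* a good chart exists as soon as `F(u⁰; ·) ≠ 0` (`exists_aChart_ne_zero`, a rational non-root via
  the Schwartz–Zippel bound).

Definitions here are plumbing with bodies (`aChart`, `sChart`, `bChart`, `lineMapU`, `linePolyU`,
`hullGenU`, `HullU`, `hGenU`, `aevalHQ`, `aevalHZ`, `gHullU`, `specPtU`); no named facts.

## References

* [NesterenkoPhilippon2001] LNM 1752 (2001), Ch. 3 §4, Prop. 4.4 (p. 38), Prop. 4.11 (pp. 40–41).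
* [Nes10] Yu. V. Nesterenko, Proc. Steklov Inst. Math. 218 (1997) 294–331, §1 (Prop. 1.4).
* [HodgePedoe1994] W. V. D. Hodge, D. Pedoe, *Methods of Algebraic Geometry* II, Ch. X §§8–11.
-/

noncomputable section

open MvPolynomial Module

attribute [local instance] MvPolynomial.gradedAlgebra

namespace Literature.NumberTheory.Transcendental

namespace Nesterenko

variable {m : ℕ}

/-! ### Products of linear polynomials in one variable: degree and top coefficient -/

/-- For `natDegree (f i) ≤ n i`: `natDegree (∏ f) ≤ ∑ n` and the coefficient of `T^{∑ n}` in `∏ f` is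
`∏ coeff (f i) (n i)`. [folklore] -/
theorem natDegree_prod_le_and_coeff {R : Type*} [CommRing R] {ι : Type*} (s : Finset ι)
    (f : ι → Polynomial R) (n : ι → ℕ) (h : ∀ i ∈ s, (f i).natDegree ≤ n i) :
    (∏ i ∈ s, f i).natDegree ≤ ∑ i ∈ s, n i ∧
      (∏ i ∈ s, f i).coeff (∑ i ∈ s, n i) = ∏ i ∈ s, (f i).coeff (n i) := by
  classical
  induction s using Finset.induction_on with
  | empty => simp
  | insert a s ha ih =>
    obtain ⟨hdeg, hcoeff⟩ := ih fun i hi => h i (Finset.mem_insert_of_mem hi)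
    have ha' := h a (Finset.mem_insert_self a s)
    rw [Finset.prod_insert ha, Finset.sum_insert ha, Finset.prod_insert ha]
    refine ⟨(Polynomial.natDegree_mul_le).trans (Nat.add_le_add ha' hdeg), ?_⟩
    rw [Polynomial.coeff_mul_add_eq_of_natDegree_le ha' hdeg, hcoeff]

/-- The line polynomial `∏ₖ (cₖ T + dₖ)^{αₖ}` has degree `≤ |α|` and top coefficient `∏ cₖ^{αₖ}`.
[folklore] -/
theorem natDegree_prod_linear_pow_le_and_coeff {R : Type*} [CommRing R] (c d : Fin (m + 1) → R)
    (α : Fin (m + 1) →₀ ℕ) :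
    (∏ k : Fin (m + 1), (Polynomial.C (c k) * Polynomial.X + Polynomial.C (d k)) ^ α k).natDegree ≤
        ∑ k, α k ∧
      (∏ k : Fin (m + 1), (Polynomial.C (c k) * Polynomial.X + Polynomial.C (d k)) ^ α k).coeff
        (∑ k, α k) = ∏ k, c k ^ α k := by
  have hlin : ∀ k, (Polynomial.C (c k) * Polynomial.X + Polynomial.C (d k)).natDegree ≤ 1 := fun k =>
    (Polynomial.natDegree_add_le _ _).trans (max_le
      ((Polynomial.natDegree_C_mul_le _ _).trans Polynomial.natDegree_X_le)
      (by rw [Polynomial.natDegree_C]; exact Nat.zero_le _))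
  have hpow : ∀ k, ((Polynomial.C (c k) * Polynomial.X + Polynomial.C (d k)) ^ α k).natDegree ≤ α k :=
    fun k => Polynomial.natDegree_pow_le.trans (by simpa using Nat.mul_le_mul_left (α k) (hlin k))
  obtain ⟨hdeg, hcoeff⟩ := natDegree_prod_le_and_coeff Finset.univ
    (fun k => (Polynomial.C (c k) * Polynomial.X + Polynomial.C (d k)) ^ α k) (fun k => α k)
    (fun k _ => hpow k)
  refine ⟨hdeg, ?_⟩
  rw [hcoeff]
  refine Finset.prod_congr rfl fun k _ => ?_
  have := Polynomial.coeff_pow_of_natDegree_le (m := α k) (hlin k)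
  rw [mul_one] at this
  rw [this, Polynomial.coeff_add, Polynomial.coeff_C_mul, Polynomial.coeff_X_one,
    Polynomial.coeff_C, if_neg one_ne_zero, mul_one, add_zero]

/-- A non-zero polynomial over a field of characteristic `0` does not vanish at some RATIONAL point
(Schwartz–Zippel on a rational grid). [folklore] -/
theorem exists_rat_eval_ne_zero {K : Type*} [Field K] [Algebra ℚ K] {P : MvPolynomial (Fin (m + 1)) K}
    (hP : P ≠ 0) : ∃ v : Fin (m + 1) → ℚ, eval (fun k => algebraMap ℚ K (v k)) P ≠ 0 := by
  classical
  by_contra hall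
  push Not at hall
  set ι : ℚ → K := fun q => algebraMap ℚ K q with hι
  have hιinj : Function.Injective ι := (algebraMap ℚ K).injective
  set S : Finset K := ((Finset.range (P.totalDegree + 1)).image (Nat.cast : ℕ → ℚ)).image ι with hS
  have hScard : S.card = P.totalDegree + 1 := by
    rw [hS, Finset.card_image_of_injective _ hιinj,
      Finset.card_image_of_injective _ Nat.cast_injective, Finset.card_range]
  have hfilt : ((Fintype.piFinset fun _ : Fin (m + 1) => S).filter fun x => eval x P = 0) =
      Fintype.piFinset fun _ : Fin (m + 1) => S := by
    refine Finset.filter_true_of_mem fun x hx => ?_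
    rw [Fintype.mem_piFinset] at hx
    have hx' : ∀ k, ∃ q : ℚ, ι q = x k := fun k => by
      obtain ⟨q, -, hq⟩ := Finset.mem_image.mp (hx k)
      exact ⟨q, hq⟩
    choose f hf using hx'
    have : x = fun k => ι (f k) := funext fun k => (hf k).symm
    rw [this]
    exact hall f
  have hsz := MvPolynomial.schwartz_zippel_totalDegree hP S
  rw [hfilt, Fintype.card_piFinset_const, hScard] at hsz
  have hpos : (0 : ℚ≥0) < (P.totalDegree + 1 : ℕ) := by positivity
  have h1 : (1 : ℚ≥0) ≤ (P.totalDegree : ℚ≥0) / (P.totalDegree + 1 : ℕ) := by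
    refine le_trans (le_of_eq ?_) hsz
    rw [eq_comm, div_eq_one_iff_eq (by positivity)]
    push_cast
    ring
  rw [le_div_iff₀ hpos, one_mul] at h1
  have h2 : P.totalDegree + 1 ≤ P.totalDegree := by exact_mod_cast h1
  omega

section Prime

variable {s : ℕ} {𝔭 : Ideal (Rx m)}

/-! ### Rational charts: `a_v = F(u₁, …, u_s; v)` -/

/-- `a_v = F(u₁, …, u_s; v) ∈ A = ℚ[u₁, …, u_s]` for a rational vector `v`. [folklore] -/
def aChart (𝔭 : Ideal (Rx m)) (s : ℕ) (v : Fin (m + 1) → ℚ) : RU s m :=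
  eval (fun k => algebraMap ℚ (RU s m) (v k)) (splitLast s m (chowForm 𝔭 (s + 1)))

/-- `v · β⁽ⁱ⁾ ∈ Ω`. [folklore] -/
def sChart (𝔭 : Ideal (Rx m)) (s : ℕ) (v : Fin (m + 1) → ℚ) (i : Fin (ideg 𝔭 (s + 1))) : ΩU s m :=
  ∑ k, algebraMap ℚ (ΩU s m) (v k) * splitPts 𝔭 s i k

/-- `A → Ω` after `ℚ → A` is `ℚ → Ω`. [folklore] -/
theorem algebraMap_ΩU_ratCast (s : ℕ) (q : ℚ) :
    algebraMap (RU s m) (ΩU s m) (algebraMap ℚ (RU s m) q) = algebraMap ℚ (ΩU s m) q :=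
  RingHom.congr_fun (Subsingleton.elim ((algebraMap (RU s m) (ΩU s m)).comp (algebraMap ℚ (RU s m)))
    (algebraMap ℚ (ΩU s m))) q

/-- `F(u'; w⁰)` at an `Ω`-point through `F_Ω`. [folklore] -/
theorem aeval_splitLast_eq_eval_chowFormΩ (𝔭 : Ideal (Rx m)) (s : ℕ) (w : Fin (m + 1) → ΩU s m) :
    aeval w (splitLast s m (chowForm 𝔭 (s + 1))) = eval w (chowFormΩ 𝔭 s) := by
  rw [chowFormΩ, eval_map, aeval_def]

/-- **`a_v = c ∏ᵢ (v · β⁽ⁱ⁾)` in `Ω`.** [cite: NesterenkoPhilippon2001, Ch. 3 Prop. 4.11 (pp. 40–41)] -/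
theorem algebraMap_aChart (h𝔭 : 𝔭.IsPrime)
    (hhom : 𝔭.IsHomogeneous (homogeneousSubmodule (Fin (m + 1)) ℚ))
    (hdim : ringKrullDim (Rx m ⧸ 𝔭) = (s + 1 : ℕ)) (v : Fin (m + 1) → ℚ) :
    algebraMap (RU s m) (ΩU s m) (aChart 𝔭 s v) = splitConst 𝔭 s * ∏ i, sChart 𝔭 s v i := by
  have h : algebraMap (RU s m) (ΩU s m) (aChart 𝔭 s v) =
      eval (fun k => algebraMap ℚ (ΩU s m) (v k)) (chowFormΩ 𝔭 s) := by
    rw [aChart, chowFormΩ, eval_map, ← coe_eval₂Hom, show (eval fun k => algebraMap ℚ (RU s m) (v k)) =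
      eval₂Hom (RingHom.id _) (fun k => algebraMap ℚ (RU s m) (v k)) from rfl, coe_eval₂Hom,
      coe_eval₂Hom, eval₂_comp_left, RingHom.comp_id]
    congr 1
    funext k
    exact algebraMap_ΩU_ratCast s (v k)
  rw [h, (splitConst_spec h𝔭 hhom hdim).2.2, eval_mul, eval_C, eval_prod]
  congr 1
  refine Finset.prod_congr rfl fun i _ => ?_
  rw [eval_linK, sChart]
  exact Finset.sum_congr rfl fun k _ => mul_comm _ _

/-- If `a_v ≠ 0` then `v · β⁽ⁱ⁾ ≠ 0`. [folklore] -/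
theorem sChart_ne_zero (h𝔭 : 𝔭.IsPrime)
    (hhom : 𝔭.IsHomogeneous (homogeneousSubmodule (Fin (m + 1)) ℚ))
    (hdim : ringKrullDim (Rx m ⧸ 𝔭) = (s + 1 : ℕ)) {v : Fin (m + 1) → ℚ} (hv : aChart 𝔭 s v ≠ 0)
    (i : Fin (ideg 𝔭 (s + 1))) : sChart 𝔭 s v i ≠ 0 := fun h0 => by
  have h := algebraMap_aChart h𝔭 hhom hdim v
  rw [Finset.prod_eq_zero (Finset.mem_univ i) h0, mul_zero] at h
  exact hv (algebraMap_ΩU_injective s m (by rw [h, map_zero]))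

/-- The section point normalised by `v · β = 1`: `b⁽ⁱ⁾ = β⁽ⁱ⁾ / (v · β⁽ⁱ⁾)`. [folklore] -/
def bChart (𝔭 : Ideal (Rx m)) (s : ℕ) (v : Fin (m + 1) → ℚ) (i : Fin (ideg 𝔭 (s + 1)))
    (k : Fin (m + 1)) : ΩU s m :=
  (sChart 𝔭 s v i)⁻¹ * splitPts 𝔭 s i k

/-- `b⁽ⁱ⁾ = (v · β⁽ⁱ⁾)⁻¹ • β⁽ⁱ⁾`. [folklore] -/
theorem bChart_eq_smul (v : Fin (m + 1) → ℚ) (i : Fin (ideg 𝔭 (s + 1))) :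
    bChart 𝔭 s v i = (sChart 𝔭 s v i)⁻¹ • splitPts 𝔭 s i := by
  funext k; rfl

/-- `v · b⁽ⁱ⁾ = 1`. [folklore] -/
theorem sum_v_mul_bChart (h𝔭 : 𝔭.IsPrime)
    (hhom : 𝔭.IsHomogeneous (homogeneousSubmodule (Fin (m + 1)) ℚ))
    (hdim : ringKrullDim (Rx m ⧸ 𝔭) = (s + 1 : ℕ)) {v : Fin (m + 1) → ℚ} (hv : aChart 𝔭 s v ≠ 0)
    (i : Fin (ideg 𝔭 (s + 1))) : ∑ k, algebraMap ℚ (ΩU s m) (v k) * bChart 𝔭 s v i k = 1 := by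
  simp only [bChart]
  calc ∑ k, algebraMap ℚ (ΩU s m) (v k) * ((sChart 𝔭 s v i)⁻¹ * splitPts 𝔭 s i k)
      = (sChart 𝔭 s v i)⁻¹ * ∑ k, algebraMap ℚ (ΩU s m) (v k) * splitPts 𝔭 s i k := by
        rw [Finset.mul_sum]; exact Finset.sum_congr rfl fun k _ => by ring
    _ = 1 := by rw [← sChart, inv_mul_cancel₀ (sChart_ne_zero h𝔭 hhom hdim hv i)]

/-! ### The line polynomials `T ↦ F(u'; T v + e_k)` and integrality -/

/-- The substitution `w ↦ T v + e_k` (`A`-algebra map `A[w] → A[T]`). [folklore] -/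
def lineMapU (s : ℕ) (v : Fin (m + 1) → ℚ) (k : Fin (m + 1)) :
    MvPolynomial (Fin (m + 1)) (RU s m) →ₐ[RU s m] Polynomial (RU s m) :=
  aeval fun k' => Polynomial.C (algebraMap ℚ (RU s m) (v k')) * Polynomial.X +
    Polynomial.C (if k' = k then 1 else 0)

/-- `P^{(v)}_k(T) = F(u₁, …, u_s; T v + e_k) ∈ A[T]`. [cite: NesterenkoPhilippon2001, Ch. 3 Prop. 4.11 (pp. 40–41)] -/
def linePolyU (𝔭 : Ideal (Rx m)) (s : ℕ) (v : Fin (m + 1) → ℚ) (k : Fin (m + 1)) :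
    Polynomial (RU s m) :=
  lineMapU s v k (splitLast s m (chowForm 𝔭 (s + 1)))

/-- Evaluating `lineMapU v k P` at `t ∈ Ω` is evaluating `P` at the point `t v + e_k`. [folklore] -/
theorem aeval_lineMapU (s : ℕ) (v : Fin (m + 1) → ℚ) (k : Fin (m + 1)) (t : ΩU s m)
    (P : MvPolynomial (Fin (m + 1)) (RU s m)) :
    Polynomial.aeval t (lineMapU s v k P) =
      aeval (fun k' => algebraMap ℚ (ΩU s m) (v k') * t + (if k' = k then 1 else 0)) P := by
  have hf : (fun k' => Polynomial.aeval t (Polynomial.C (algebraMap ℚ (RU s m) (v k')) * Polynomial.X +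
      Polynomial.C (if k' = k then 1 else 0))) =
      fun k' => algebraMap ℚ (ΩU s m) (v k') * t + (if k' = k then 1 else 0) := by
    funext k'
    rw [map_add, map_mul, Polynomial.aeval_C, Polynomial.aeval_X, Polynomial.aeval_C,
      algebraMap_ΩU_ratCast]
    split_ifs <;> simp
  rw [lineMapU, ← AlgHom.comp_apply, comp_aeval, hf]

/-- **`−b⁽ⁱ⁾_k` is a root of `P^{(v)}_k`** (the `i`-th factor of the generic splitting vanishes at
`w = −b⁽ⁱ⁾_k v + e_k`). [cite: NesterenkoPhilippon2001, Ch. 3 Prop. 4.11 (pp. 40–41)] -/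
theorem aeval_linePolyU_neg_bChart (h𝔭 : 𝔭.IsPrime)
    (hhom : 𝔭.IsHomogeneous (homogeneousSubmodule (Fin (m + 1)) ℚ))
    (hdim : ringKrullDim (Rx m ⧸ 𝔭) = (s + 1 : ℕ)) {v : Fin (m + 1) → ℚ} (hv : aChart 𝔭 s v ≠ 0)
    (i : Fin (ideg 𝔭 (s + 1))) (k : Fin (m + 1)) :
    Polynomial.aeval (-bChart 𝔭 s v i k) (linePolyU 𝔭 s v k) = 0 := by
  rw [linePolyU, aeval_lineMapU, aeval_splitLast_eq_eval_chowFormΩ, (splitConst_spec h𝔭 hhom hdim).2.2,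
    eval_mul, eval_prod, Finset.prod_eq_zero (Finset.mem_univ i), mul_zero]
  rw [eval_linK]
  calc ∑ k', splitPts 𝔭 s i k' * (algebraMap ℚ (ΩU s m) (v k') * -bChart 𝔭 s v i k + if k' = k then 1 else 0)
      = -(bChart 𝔭 s v i k) * (∑ k', algebraMap ℚ (ΩU s m) (v k') * splitPts 𝔭 s i k') +
          ∑ k', splitPts 𝔭 s i k' * (if k' = k then 1 else 0) := by
        rw [Finset.mul_sum, ← Finset.sum_add_distrib]
        exact Finset.sum_congr rfl fun k' _ => by ring
    _ = 0 := by
        simp_rw [mul_boole]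
        rw [Finset.sum_ite_eq' Finset.univ k, if_pos (Finset.mem_univ k), ← sChart, bChart]
        field_simp [sChart_ne_zero h𝔭 hhom hdim hv i]
        ring

/-- `F(u'; w)` is homogeneous of degree `D` in `w` over `A`. [folklore] -/
theorem isHomogeneous_splitLast_chowForm (𝔭 : Ideal (Rx m)) (s : ℕ) :
    (splitLast s m (chowForm 𝔭 (s + 1))).IsHomogeneous (ideg 𝔭 (s + 1)) := by
  have h := isHomogeneous_map_splitLast (RingHom.id (RU s m))
    (chowForm_isWeightedHomogeneous 𝔭 (Nat.succ_pos s) (Fin.last s))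
  rwa [MvPolynomial.map_id] at h

/-- Homogeneity of `F(u'; w)`: every monomial has degree `D` in `w`. [folklore] -/
theorem sum_eq_ideg_of_mem_support_splitLast {α : Fin (m + 1) →₀ ℕ}
    (hα : α ∈ (splitLast s m (chowForm 𝔭 (s + 1))).support) : ∑ k, α k = ideg 𝔭 (s + 1) := by
  have h := isHomogeneous_splitLast_chowForm 𝔭 s (mem_support_iff.mp hα)
  rw [Finsupp.weight_apply, Finsupp.sum_fintype _ _ (fun i => by simp)] at h
  simpa using h

/-- **`deg P^{(v)}_k ≤ D` and its `T^D`-coefficient is `a_v`.**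
[cite: NesterenkoPhilippon2001, Ch. 3 Prop. 4.11 (pp. 40–41)] -/
theorem natDegree_linePolyU_le_and_coeff (v : Fin (m + 1) → ℚ) (k : Fin (m + 1)) :
    (linePolyU 𝔭 s v k).natDegree ≤ ideg 𝔭 (s + 1) ∧
      (linePolyU 𝔭 s v k).coeff (ideg 𝔭 (s + 1)) = aChart 𝔭 s v := by
  classical
  set P := splitLast s m (chowForm 𝔭 (s + 1)) with hP
  set c : Fin (m + 1) → RU s m := fun k' => algebraMap ℚ (RU s m) (v k') with hc
  set d : Fin (m + 1) → RU s m := fun k' => if k' = k then 1 else 0 with hd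
  have hterm : ∀ α ∈ P.support,
      lineMapU s v k (monomial α (coeff α P)) =
        Polynomial.C (coeff α P) * ∏ k', (Polynomial.C (c k') * Polynomial.X + Polynomial.C (d k')) ^ α k' := by
    intro α _
    rw [lineMapU, aeval_monomial, Finsupp.prod_pow, Polynomial.algebraMap_eq]
  have hsum : linePolyU 𝔭 s v k = ∑ α ∈ P.support, Polynomial.C (coeff α P) *
      ∏ k', (Polynomial.C (c k') * Polynomial.X + Polynomial.C (d k')) ^ α k' := by
    rw [linePolyU, ← hP]
    conv_lhs => rw [P.as_sum, map_sum]
    exact Finset.sum_congr rfl hterm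
  have hfac : ∀ α ∈ P.support,
      (Polynomial.C (coeff α P) *
        ∏ k', (Polynomial.C (c k') * Polynomial.X + Polynomial.C (d k')) ^ α k').natDegree ≤
          ideg 𝔭 (s + 1) ∧
      (Polynomial.C (coeff α P) *
        ∏ k', (Polynomial.C (c k') * Polynomial.X + Polynomial.C (d k')) ^ α k').coeff
          (ideg 𝔭 (s + 1)) = coeff α P * ∏ k', c k' ^ α k' := by
    intro α hα
    obtain ⟨hdeg, hcoeff⟩ := natDegree_prod_linear_pow_le_and_coeff c d α
    rw [sum_eq_ideg_of_mem_support_splitLast hα] at hdeg hcoeff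
    exact ⟨(Polynomial.natDegree_C_mul_le _ _).trans hdeg, by rw [Polynomial.coeff_C_mul, hcoeff]⟩
  constructor
  · rw [hsum]
    exact Polynomial.natDegree_sum_le_of_forall_le _ _ fun α hα => (hfac α hα).1
  · rw [hsum, Polynomial.finsetSum_coeff, aChart, eval_eq']
    exact Finset.sum_congr rfl fun α hα => (hfac α hα).2

/-- For `a_v ≠ 0`: the leading coefficient of `P^{(v)}_k` is `a_v`. [folklore] -/
theorem leadingCoeff_linePolyU {v : Fin (m + 1) → ℚ} (hv : aChart 𝔭 s v ≠ 0) (k : Fin (m + 1)) :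
    (linePolyU 𝔭 s v k).leadingCoeff = aChart 𝔭 s v := by
  obtain ⟨hdeg, hcoeff⟩ := natDegree_linePolyU_le_and_coeff (𝔭 := 𝔭) (s := s) v k
  have hnat : (linePolyU 𝔭 s v k).natDegree = ideg 𝔭 (s + 1) :=
    le_antisymm hdeg (Polynomial.le_natDegree_of_ne_zero (by rw [hcoeff]; exact hv))
  rw [Polynomial.leadingCoeff, hnat, hcoeff]

/-- **`a_v b⁽ⁱ⁾_k` is integral over `A`.** [cite: NesterenkoPhilippon2001, Ch. 3 Prop. 4.11 (pp. 40–41)] -/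
theorem isIntegral_aChart_mul_bChart (h𝔭 : 𝔭.IsPrime)
    (hhom : 𝔭.IsHomogeneous (homogeneousSubmodule (Fin (m + 1)) ℚ))
    (hdim : ringKrullDim (Rx m ⧸ 𝔭) = (s + 1 : ℕ)) {v : Fin (m + 1) → ℚ} (hv : aChart 𝔭 s v ≠ 0)
    (i : Fin (ideg 𝔭 (s + 1))) (k : Fin (m + 1)) :
    IsIntegral (RU s m) (algebraMap (RU s m) (ΩU s m) (aChart 𝔭 s v) * bChart 𝔭 s v i k) := by
  have h := isIntegral_leadingCoeff_smul (R := RU s m) _ _ (aeval_linePolyU_neg_bChart h𝔭 hhom hdim hv i k)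
  rw [leadingCoeff_linePolyU hv, smul_neg] at h
  have h' := h.neg
  rw [neg_neg, Algebra.smul_def] at h'
  exact h'

/-! ### The integral hull `S = A[a_v b⁽ⁱ⁾_k] ⊂ Ω` and the specialisation `S → K` -/

/-- The generators `a_v b⁽ⁱ⁾_k`. [folklore] -/
def hullGenU (𝔭 : Ideal (Rx m)) (s : ℕ) (v : Fin (m + 1) → ℚ)
    (p : Fin (ideg 𝔭 (s + 1)) × Fin (m + 1)) : ΩU s m :=
  algebraMap (RU s m) (ΩU s m) (aChart 𝔭 s v) * bChart 𝔭 s v p.1 p.2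

/-- **`S = A[a_v b⁽ⁱ⁾_k]`.** [folklore] -/
def HullU (𝔭 : Ideal (Rx m)) (s : ℕ) (v : Fin (m + 1) → ℚ) : Subalgebra (RU s m) (ΩU s m) :=
  Algebra.adjoin (RU s m) (Set.range (hullGenU 𝔭 s v))

/-- Short-cut instance (the generic search times out). [folklore] -/
instance algebraHullU (v : Fin (m + 1) → ℚ) : Algebra (RU s m) (HullU 𝔭 s v) := (HullU 𝔭 s v).algebra

/-- Short-cut instance. [folklore] -/
instance smulHullU (v : Fin (m + 1) → ℚ) : SMul (RU s m) (HullU 𝔭 s v) := Algebra.toSMul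

/-- Short-cut instance. [folklore] -/
instance moduleHullU (v : Fin (m + 1) → ℚ) : Module (RU s m) (HullU 𝔭 s v) := Algebra.toModule

/-- The structure map `A → S` coerced to `Ω`. [folklore] -/
theorem coe_algebraMap_HullU (v : Fin (m + 1) → ℚ) (x : RU s m) :
    ((algebraMap (RU s m) (HullU 𝔭 s v) x : HullU 𝔭 s v) : ΩU s m) = algebraMap (RU s m) (ΩU s m) x :=
  rfl

/-- `A → S` is injective. [folklore] -/
theorem algebraMap_HullU_injective (v : Fin (m + 1) → ℚ) :
    Function.Injective (algebraMap (RU s m) (HullU 𝔭 s v)) := fun x y h =>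
  algebraMap_ΩU_injective s m (by
    rw [← coe_algebraMap_HullU (𝔭 := 𝔭) v, ← coe_algebraMap_HullU (𝔭 := 𝔭) v, h])

/-- `A → S` is injective (instance form). [folklore] -/
instance faithfulSMulHullU (v : Fin (m + 1) → ℚ) : FaithfulSMul (RU s m) (HullU 𝔭 s v) :=
  (faithfulSMul_iff_algebraMap_injective _ _).mpr (algebraMap_HullU_injective v)

/-- `a_v b⁽ⁱ⁾_k ∈ S`. [folklore] -/
theorem hullGenU_mem (v : Fin (m + 1) → ℚ) (i : Fin (ideg 𝔭 (s + 1))) (k : Fin (m + 1)) :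
    hullGenU 𝔭 s v (i, k) ∈ HullU 𝔭 s v :=
  Algebra.subset_adjoin ⟨(i, k), rfl⟩

/-- `a_v b⁽ⁱ⁾` as a tuple of elements of `S`. [folklore] -/
def hGenU (𝔭 : Ideal (Rx m)) (s : ℕ) (v : Fin (m + 1) → ℚ) (i : Fin (ideg 𝔭 (s + 1)))
    (k : Fin (m + 1)) : HullU 𝔭 s v :=
  ⟨hullGenU 𝔭 s v (i, k), hullGenU_mem v i k⟩

/-- `hGenU` coerced. [folklore] -/
theorem coe_hGenU (v : Fin (m + 1) → ℚ) (i : Fin (ideg 𝔭 (s + 1))) (k : Fin (m + 1)) :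
    (hGenU 𝔭 s v i k : ΩU s m) = algebraMap (RU s m) (ΩU s m) (aChart 𝔭 s v) * bChart 𝔭 s v i k := rfl

/-- **`S` is integral over `A`** (for `a_v ≠ 0`). [folklore] -/
theorem isIntegral_HullU (h𝔭 : 𝔭.IsPrime)
    (hhom : 𝔭.IsHomogeneous (homogeneousSubmodule (Fin (m + 1)) ℚ))
    (hdim : ringKrullDim (Rx m ⧸ 𝔭) = (s + 1 : ℕ)) {v : Fin (m + 1) → ℚ} (hv : aChart 𝔭 s v ≠ 0) :
    Algebra.IsIntegral (RU s m) (HullU 𝔭 s v) :=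
  ⟨fun x => by
    have hle : HullU 𝔭 s v ≤ integralClosure (RU s m) (ΩU s m) := by
      refine Algebra.adjoin_le ?_
      rintro _ ⟨⟨i, k⟩, rfl⟩
      exact isIntegral_aChart_mul_bChart h𝔭 hhom hdim hv i k
    have hx : IsIntegral (RU s m) (x : ΩU s m) := hle x.2
    exact (isIntegral_algHom_iff (HullU 𝔭 s v).val Subtype.val_injective).mp hx⟩

section Specialize

variable {K : Type*} [Field K] [Algebra ℚ K]

/-- Evaluation at `u⁰`. [folklore] -/
def evU (u : Fin s × Fin (m + 1) → K) : RU s m →+* K := (aeval u : RU s m →ₐ[ℚ] K)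

/-- `evU` unfolded. [folklore] -/
theorem evU_apply (u : Fin s × Fin (m + 1) → K) (x : RU s m) : evU u x = aeval u x := rfl

variable [IsAlgClosed K]

/-- **The evaluation `A → K` at `u⁰` extends to the integral hull `S`** (lying over + extension of
embeddings into the algebraically closed field `K`). [folklore] -/
theorem exists_specializationU (h𝔭 : 𝔭.IsPrime)
    (hhom : 𝔭.IsHomogeneous (homogeneousSubmodule (Fin (m + 1)) ℚ))
    (hdim : ringKrullDim (Rx m ⧸ 𝔭) = (s + 1 : ℕ)) {v : Fin (m + 1) → ℚ} (hv : aChart 𝔭 s v ≠ 0)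
    (u : Fin s × Fin (m + 1) → K) :
    ∃ φ : HullU 𝔭 s v →+* K, ∀ x : RU s m, φ (algebraMap (RU s m) (HullU 𝔭 s v) x) = aeval u x := by
  haveI := isIntegral_HullU h𝔭 hhom hdim hv
  set P : Ideal (RU s m) := RingHom.ker (evU u) with hP
  haveI : P.IsPrime := RingHom.ker_isPrime _
  obtain ⟨𝔓, -, h𝔓, hcomap⟩ := Ideal.exists_ideal_over_prime_of_isIntegral (S := HullU 𝔭 s v) P ⊥
    (by
      rw [← RingHom.ker_eq_comap_bot,
        (RingHom.injective_iff_ker_eq_bot _).mp (algebraMap_HullU_injective v)]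
      exact bot_le)
  haveI := h𝔓
  set P' : Ideal (RU s m) := 𝔓.comap (algebraMap (RU s m) (HullU 𝔭 s v)) with hP'
  haveI : P'.IsPrime := Ideal.comap_isPrime _ _
  have hker : ∀ x ∈ P', evU u x = 0 := fun x hx => by
    have hx' : x ∈ P := hcomap ▸ hx
    exact hx'
  letI algQ : Algebra (RU s m ⧸ P') (HullU 𝔭 s v ⧸ 𝔓) := Ideal.Quotient.algebraQuotientOfLEComap le_rfl
  letI : SMul (RU s m ⧸ P') (HullU 𝔭 s v ⧸ 𝔓) := Algebra.toSMul
  letI : Module (RU s m ⧸ P') (HullU 𝔭 s v ⧸ 𝔓) := Algebra.toModule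
  letI algK : Algebra (RU s m ⧸ P') K := (Ideal.Quotient.lift P' (evU u) hker).toAlgebra
  letI : SMul (RU s m ⧸ P') K := Algebra.toSMul
  letI : Module (RU s m ⧸ P') K := Algebra.toModule
  haveI : IsDomain (HullU 𝔭 s v ⧸ 𝔓) := Ideal.Quotient.isDomain 𝔓
  haveI : IsDomain (RU s m ⧸ P') := Ideal.Quotient.isDomain P'
  haveI : FaithfulSMul (RU s m ⧸ P') (HullU 𝔭 s v ⧸ 𝔓) :=
    (faithfulSMul_iff_algebraMap_injective _ _).mpr Ideal.algebraMap_quotient_injective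
  haveI : FaithfulSMul (RU s m ⧸ P') K :=
    (faithfulSMul_iff_algebraMap_injective _ _).mpr
      (RingHom.lift_injective_of_ker_le_ideal P' hker (by rw [hcomap]))
  haveI : Module.IsTorsionFree (RU s m ⧸ P') (HullU 𝔭 s v ⧸ 𝔓) := FaithfulSMul.to_isTorsionFree _ _
  haveI : Module.IsTorsionFree (RU s m ⧸ P') K := FaithfulSMul.to_isTorsionFree _ _
  haveI : Algebra.IsIntegral (RU s m ⧸ P') (HullU 𝔭 s v ⧸ 𝔓) := Algebra.IsIntegral.quotient
  haveI : Algebra.IsAlgebraic (RU s m ⧸ P') (HullU 𝔭 s v ⧸ 𝔓) := Algebra.IsIntegral.isAlgebraic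
  let ψ : (HullU 𝔭 s v ⧸ 𝔓) →ₐ[RU s m ⧸ P'] K := IsAlgClosed.lift
  refine ⟨ψ.toRingHom.comp (Ideal.Quotient.mk 𝔓), fun x => ?_⟩
  change ψ (Ideal.Quotient.mk 𝔓 (algebraMap (RU s m) (HullU 𝔭 s v) x)) = _
  rw [show Ideal.Quotient.mk 𝔓 (algebraMap (RU s m) (HullU 𝔭 s v) x) =
      algebraMap (RU s m ⧸ P') (HullU 𝔭 s v ⧸ 𝔓) (Ideal.Quotient.mk P' x) from rfl, AlgHom.commutes]
  change Ideal.Quotient.lift P' (evU u) hker (Ideal.Quotient.mk P' x) = _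
  rw [Ideal.Quotient.lift_mk, evU_apply]

end Specialize

/-! ### Identities in the hull `S` -/

variable {v : Fin (m + 1) → ℚ}

/-- Evaluating the INTEGER form `Q₀` at `a_v b⁽ⁱ⁾` inside `S`. [folklore] -/
def aevalHZ (𝔭 : Ideal (Rx m)) (s : ℕ) (v : Fin (m + 1) → ℚ) (i : Fin (ideg 𝔭 (s + 1)))
    (Q₀ : MvPolynomial (Fin (m + 1)) ℤ) : HullU 𝔭 s v :=
  aeval (hGenU 𝔭 s v i) Q₀

/-- A ring map out of `S` applied to `aevalHZ` (integer polynomials commute with ring maps).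
[folklore] -/
theorem ringHom_aevalHZ {T : Type*} [CommRing T] (ψ : HullU 𝔭 s v →+* T) (i : Fin (ideg 𝔭 (s + 1)))
    (Q₀ : MvPolynomial (Fin (m + 1)) ℤ) :
    ψ (aevalHZ 𝔭 s v i Q₀) = aeval (fun k => ψ (hGenU 𝔭 s v i k)) Q₀ := by
  rw [aevalHZ, aeval_def, aeval_def, eval₂_comp_left,
    Subsingleton.elim (ψ.comp (algebraMap ℤ (HullU 𝔭 s v))) (algebraMap ℤ T)]
  rfl

/-- Evaluating a RATIONAL polynomial at `a_v b⁽ⁱ⁾` inside `S` (through `ℚ → A → S`). [folklore] -/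
def aevalHQ (𝔭 : Ideal (Rx m)) (s : ℕ) (v : Fin (m + 1) → ℚ) (i : Fin (ideg 𝔭 (s + 1)))
    (P : Rx m) : HullU 𝔭 s v :=
  eval₂ ((algebraMap (RU s m) (HullU 𝔭 s v)).comp (algebraMap ℚ (RU s m))) (hGenU 𝔭 s v i) P

/-- A ring map out of `S` into a `ℚ`-algebra applied to `aevalHQ`. [folklore] -/
theorem ringHom_aevalHQ {T : Type*} [CommRing T] [Algebra ℚ T] (ψ : HullU 𝔭 s v →+* T)
    (i : Fin (ideg 𝔭 (s + 1))) (P : Rx m) :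
    ψ (aevalHQ 𝔭 s v i P) = aeval (fun k => ψ (hGenU 𝔭 s v i k)) P := by
  rw [aevalHQ, eval₂_comp_left, aeval_def,
    Subsingleton.elim (ψ.comp ((algebraMap (RU s m) (HullU 𝔭 s v)).comp (algebraMap ℚ (RU s m))))
      (algebraMap ℚ T)]
  rfl

/-- `a_v b⁽ⁱ⁾` is a zero of `𝔭`, inside `S` (scaling of the section point `β⁽ⁱ⁾`; `𝔭` homogeneous).
[folklore] -/
theorem aevalHQ_eq_zero (h𝔭 : 𝔭.IsPrime)
    (hhom : 𝔭.IsHomogeneous (homogeneousSubmodule (Fin (m + 1)) ℚ))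
    (hdim : ringKrullDim (Rx m ⧸ 𝔭) = (s + 1 : ℕ)) (v : Fin (m + 1) → ℚ) (i : Fin (ideg 𝔭 (s + 1)))
    {P : Rx m} (hP : P ∈ 𝔭) : aevalHQ 𝔭 s v i P = 0 := by
  apply Subtype.val_injective
  rw [show ((aevalHQ 𝔭 s v i P : HullU 𝔭 s v) : ΩU s m) =
      ((HullU 𝔭 s v).val : HullU 𝔭 s v →+* ΩU s m) (aevalHQ 𝔭 s v i P) from rfl, ringHom_aevalHQ]
  change aeval (fun k => algebraMap (RU s m) (ΩU s m) (aChart 𝔭 s v) * bChart 𝔭 s v i k) P = 0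
  have hsm : (fun k => algebraMap (RU s m) (ΩU s m) (aChart 𝔭 s v) * bChart 𝔭 s v i k) =
      (algebraMap (RU s m) (ΩU s m) (aChart 𝔭 s v) * (sChart 𝔭 s v i)⁻¹) • splitPts 𝔭 s i := by
    funext k; simp only [bChart, Pi.smul_apply, smul_eq_mul]; ring
  rw [hsm]
  exact NesterenkoK.aeval_smul_eq_zero_of_forall hhom ((splitConst_spec h𝔭 hhom hdim).2.1 i).2.1 _ P hP

/-- `a_v b⁽ⁱ⁾` lies on the generic hyperplanes, inside `S`. [folklore] -/
theorem sum_algebraMap_X_mul_hGenU (h𝔭 : 𝔭.IsPrime)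
    (hhom : 𝔭.IsHomogeneous (homogeneousSubmodule (Fin (m + 1)) ℚ))
    (hdim : ringKrullDim (Rx m ⧸ 𝔭) = (s + 1 : ℕ)) (v : Fin (m + 1) → ℚ) (i : Fin (ideg 𝔭 (s + 1)))
    (i' : Fin s) : ∑ k : Fin (m + 1), algebraMap (RU s m) (HullU 𝔭 s v) (X (i', k)) * hGenU 𝔭 s v i k = 0 := by
  apply Subtype.val_injective
  change ((HullU 𝔭 s v).val : HullU 𝔭 s v →+* ΩU s m)
      (∑ k, algebraMap (RU s m) (HullU 𝔭 s v) (X (i', k)) * hGenU 𝔭 s v i k) =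
    ((HullU 𝔭 s v).val : HullU 𝔭 s v →+* ΩU s m) 0
  rw [map_sum, map_zero]
  have h1 : ∀ k, ((HullU 𝔭 s v).val : HullU 𝔭 s v →+* ΩU s m)
      (algebraMap (RU s m) (HullU 𝔭 s v) (X (i', k)) * hGenU 𝔭 s v i k) =
      (algebraMap (RU s m) (ΩU s m) (aChart 𝔭 s v) * (sChart 𝔭 s v i)⁻¹) *
        (splitPts 𝔭 s i k * uΩ s m (i', k)) := fun k => by
    rw [map_mul]
    change algebraMap (RU s m) (ΩU s m) (X (i', k)) * (algebraMap (RU s m) (ΩU s m) (aChart 𝔭 s v) *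
      bChart 𝔭 s v i k) = _
    rw [bChart, uΩ]
    ring
  rw [Finset.sum_congr rfl fun k _ => h1 k, ← Finset.mul_sum,
    ((splitConst_spec h𝔭 hhom hdim).2.1 i).2.2 i', mul_zero]

/-- `F(u'; w)` with coefficients in `S`. [folklore] -/
def gHullU (𝔭 : Ideal (Rx m)) (s : ℕ) (v : Fin (m + 1) → ℚ) : MvPolynomial (Fin (m + 1)) (HullU 𝔭 s v) :=
  map (algebraMap (RU s m) (HullU 𝔭 s v)) (splitLast s m (chowForm 𝔭 (s + 1)))

/-- `gHullU` pushed to `Ω` is `F_Ω`. [folklore] -/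
theorem map_val_gHullU (v : Fin (m + 1) → ℚ) :
    map ((HullU 𝔭 s v).val : HullU 𝔭 s v →+* ΩU s m) (gHullU 𝔭 s v) = chowFormΩ 𝔭 s := by
  rw [gHullU, map_map]
  rfl

/-- **The generic splitting inside `S[w]`**: `a_v^{D−1} F(u'; w) = ∏ᵢ ℓ_{a_v b⁽ⁱ⁾}`.
[cite: NesterenkoPhilippon2001, Ch. 3 Prop. 4.11 (pp. 40–41)] -/
theorem gHullU_identity (h𝔭 : 𝔭.IsPrime)
    (hhom : 𝔭.IsHomogeneous (homogeneousSubmodule (Fin (m + 1)) ℚ))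
    (hdim : ringKrullDim (Rx m ⧸ 𝔭) = (s + 1 : ℕ)) {v : Fin (m + 1) → ℚ} (hv : aChart 𝔭 s v ≠ 0)
    (hD : 1 ≤ ideg 𝔭 (s + 1)) :
    C (algebraMap (RU s m) (HullU 𝔭 s v) (aChart 𝔭 s v) ^ (ideg 𝔭 (s + 1) - 1)) * gHullU 𝔭 s v =
      ∏ i : Fin (ideg 𝔭 (s + 1)), (∑ k, C (hGenU 𝔭 s v i k) * X k) := by
  apply map_injective ((HullU 𝔭 s v).val : HullU 𝔭 s v →+* ΩU s m) Subtype.val_injective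
  rw [map_mul, map_C, map_val_gHullU, map_prod]
  set av : ΩU s m := algebraMap (RU s m) (ΩU s m) (aChart 𝔭 s v) with hav
  have h1 : ∀ i : Fin (ideg 𝔭 (s + 1)),
      map ((HullU 𝔭 s v).val : HullU 𝔭 s v →+* ΩU s m) (∑ k, C (hGenU 𝔭 s v i k) * X k) =
        C (av * (sChart 𝔭 s v i)⁻¹) * (∑ k, C (splitPts 𝔭 s i k) * X k) := fun i => by
    rw [← linK_smul]
    simp only [map_sum, map_mul, map_C, map_X]
    refine Finset.sum_congr rfl fun k _ => ?_
    congr 2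
    change av * bChart 𝔭 s v i k = _
    rw [bChart, Pi.smul_apply, smul_eq_mul, mul_assoc]
  simp_rw [h1]
  rw [Finset.prod_mul_distrib, ← map_prod, Finset.prod_mul_distrib, Finset.prod_const, Finset.card_univ,
    Fintype.card_fin, Finset.prod_inv_distrib]
  -- `a_v = c ∏ sChart`
  obtain ⟨hc, -, hF⟩ := splitConst_spec h𝔭 hhom hdim
  set S : ΩU s m := ∏ i : Fin (ideg 𝔭 (s + 1)), sChart 𝔭 s v i with hSdef
  have havS : av = splitConst 𝔭 s * S := by rw [hav, algebraMap_aChart h𝔭 hhom hdim]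
  have hS0 : S ≠ 0 := Finset.prod_ne_zero_iff.mpr fun i _ => sChart_ne_zero h𝔭 hhom hdim hv i
  have hprod : ∏ i : Fin (ideg 𝔭 (s + 1)), (∑ k, C (splitPts 𝔭 s i k) * X k) =
      C (splitConst 𝔭 s)⁻¹ * chowFormΩ 𝔭 s := by
    rw [hF, ← mul_assoc, ← map_mul, inv_mul_cancel₀ hc, C_1, one_mul]
  rw [hprod, ← mul_assoc, ← map_mul, map_pow]
  change C (av ^ (ideg 𝔭 (s + 1) - 1)) * chowFormΩ 𝔭 s = C (av ^ ideg 𝔭 (s + 1) * S⁻¹ * (splitConst 𝔭 s)⁻¹) * chowFormΩ 𝔭 s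
  congr 2
  obtain ⟨D', hD'⟩ : ∃ D', ideg 𝔭 (s + 1) = D' + 1 := ⟨ideg 𝔭 (s + 1) - 1, by omega⟩
  have hcancel : splitConst 𝔭 s * S * S⁻¹ * (splitConst 𝔭 s)⁻¹ = 1 := by
    rw [mul_assoc (splitConst 𝔭 s), mul_inv_cancel₀ hS0, mul_one, mul_inv_cancel₀ hc]
  rw [hD', Nat.add_sub_cancel, pow_succ, havS, mul_assoc ((splitConst 𝔭 s * S) ^ D'),
    mul_assoc ((splitConst 𝔭 s * S) ^ D'), hcancel, mul_one]

/-- **The `u`-resultant inside `S`**: `a_v^{dD} G = a_v^d ∏ᵢ Q₀(a_v b⁽ⁱ⁾)`.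
[cite: NesterenkoPhilippon2001, Ch. 3 Prop. 4.11 (pp. 40–41)] -/
theorem uResultant_identity (h𝔭 : 𝔭.IsPrime)
    (hhom : 𝔭.IsHomogeneous (homogeneousSubmodule (Fin (m + 1)) ℚ))
    (hdim : ringKrullDim (Rx m ⧸ 𝔭) = (s + 1 : ℕ)) {d : ℕ} {Q₀ : MvPolynomial (Fin (m + 1)) ℤ}
    (hQ : Q₀.IsHomogeneous d) {v : Fin (m + 1) → ℚ} (hv : aChart 𝔭 s v ≠ 0) (hD : 1 ≤ ideg 𝔭 (s + 1)) :
    algebraMap (RU s m) (HullU 𝔭 s v) (aChart 𝔭 s v ^ (d * ideg 𝔭 (s + 1)) * uResultant 𝔭 s d Q₀) =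
      algebraMap (RU s m) (HullU 𝔭 s v) (aChart 𝔭 s v) ^ d *
        ∏ i : Fin (ideg 𝔭 (s + 1)), aevalHZ 𝔭 s v i Q₀ := by
  apply Subtype.val_injective
  change ((HullU 𝔭 s v).val : HullU 𝔭 s v →+* ΩU s m)
      (algebraMap (RU s m) (HullU 𝔭 s v) (aChart 𝔭 s v ^ (d * ideg 𝔭 (s + 1)) * uResultant 𝔭 s d Q₀)) =
    ((HullU 𝔭 s v).val : HullU 𝔭 s v →+* ΩU s m) (algebraMap (RU s m) (HullU 𝔭 s v) (aChart 𝔭 s v) ^ d *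
        ∏ i : Fin (ideg 𝔭 (s + 1)), aevalHZ 𝔭 s v i Q₀)
  rw [map_mul ((HullU 𝔭 s v).val : HullU 𝔭 s v →+* ΩU s m), map_pow, map_prod]
  set av : ΩU s m := algebraMap (RU s m) (ΩU s m) (aChart 𝔭 s v) with hav
  have hval : ∀ i : Fin (ideg 𝔭 (s + 1)), ((HullU 𝔭 s v).val : HullU 𝔭 s v →+* ΩU s m) (aevalHZ 𝔭 s v i Q₀) =
      (av * (sChart 𝔭 s v i)⁻¹) ^ d * aeval (splitPts 𝔭 s i) Q₀ := fun i => by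
    rw [ringHom_aevalHZ]
    have : (fun k => ((HullU 𝔭 s v).val : HullU 𝔭 s v →+* ΩU s m) (hGenU 𝔭 s v i k)) =
        (av * (sChart 𝔭 s v i)⁻¹) • splitPts 𝔭 s i := by
      funext k
      change av * bChart 𝔭 s v i k = _
      simp only [bChart, Pi.smul_apply, smul_eq_mul]
      ring
    rw [this]
    convert aeval_smul_of_isHomogeneous_int (S := ΩU s m) hQ (av * (sChart 𝔭 s v i)⁻¹)
      (splitPts 𝔭 s i) using 2
    simp only [aeval_def]
    congr 1
    exact Subsingleton.elim _ _
  simp_rw [hval]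
  set S : ΩU s m := ∏ i : Fin (ideg 𝔭 (s + 1)), sChart 𝔭 s v i with hSdef
  set PQ : ΩU s m := ∏ i : Fin (ideg 𝔭 (s + 1)), aeval (splitPts 𝔭 s i) Q₀ with hPQ
  -- the `u`-resultant in `Ω` (bridging the two `ℤ`-algebra structures on `Ω`)
  have hbridge : uResΩ 𝔭 s d Q₀ = splitConst 𝔭 s ^ d * PQ := by
    rw [uResΩ, splitNorm, hPQ]
    congr 1
    refine Finset.prod_congr rfl fun i _ => ?_
    simp only [aeval_def]
    congr 1
    exact Subsingleton.elim _ _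
  change algebraMap (RU s m) (ΩU s m) (aChart 𝔭 s v ^ (d * ideg 𝔭 (s + 1)) * uResultant 𝔭 s d Q₀) =
    av ^ d * ∏ i : Fin (ideg 𝔭 (s + 1)), ((av * (sChart 𝔭 s v i)⁻¹) ^ d * aeval (splitPts 𝔭 s i) Q₀)
  rw [map_mul, map_pow, ← hav, algebraMap_uResultant h𝔭 hhom hdim hQ, hbridge,
    Finset.prod_mul_distrib, ← hPQ, Finset.prod_pow, Finset.prod_mul_distrib, Finset.prod_const,
    Finset.card_univ, Fintype.card_fin, Finset.prod_inv_distrib, ← hSdef]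
  have havS : av = splitConst 𝔭 s * S := by rw [hav, algebraMap_aChart h𝔭 hhom hdim]
  have hS0 : S ≠ 0 := Finset.prod_ne_zero_iff.mpr fun i _ => sChart_ne_zero h𝔭 hhom hdim hv i
  have hc0 : splitConst 𝔭 s ≠ 0 := (splitConst_spec h𝔭 hhom hdim).1
  obtain ⟨D', hD'⟩ : ∃ D', ideg 𝔭 (s + 1) = D' + 1 := ⟨ideg 𝔭 (s + 1) - 1, by omega⟩
  have hpow : av ^ ideg 𝔭 (s + 1) * S⁻¹ = splitConst 𝔭 s ^ (D' + 1) * S ^ D' := by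
    rw [hD', havS, mul_pow, pow_succ S, mul_assoc, mul_assoc, mul_inv_cancel₀ hS0, mul_one]
  rw [hpow, havS, hD']
  ring

/-! ### Specialised points and the pointwise product formula -/

section Pointwise

variable {K : Type*} [Field K] [Algebra ℚ K] (u : Fin s × Fin (m + 1) → K) (v : Fin (m + 1) → ℚ)
  (φ : HullU 𝔭 s v →+* K)

/-- The specialised points `γ⁽ⁱ⁾ = φ(a_v b⁽ⁱ⁾) / a_v(u⁰)`. [folklore] -/
def specPtU (i : Fin (ideg 𝔭 (s + 1))) (k : Fin (m + 1)) : K :=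
  (aeval u (aChart 𝔭 s v))⁻¹ * φ (hGenU 𝔭 s v i k)

variable {u v φ} (hφ : ∀ x : RU s m, φ (algebraMap (RU s m) (HullU 𝔭 s v) x) = aeval u x)
  (hu : aeval u (aChart 𝔭 s v) ≠ 0)
include hu

/-- As tuples: `φ ∘ (a_v b⁽ⁱ⁾) = a_v(u⁰) • γ⁽ⁱ⁾`. [folklore] -/
theorem phi_hGenU_eq_smul (i : Fin (ideg 𝔭 (s + 1))) :
    (fun k => φ (hGenU 𝔭 s v i k)) = aeval u (aChart 𝔭 s v) • specPtU u v φ i := by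
  funext k
  rw [Pi.smul_apply, smul_eq_mul, specPtU, ← mul_assoc, mul_inv_cancel₀ hu, one_mul]

include hφ

/-- **`v · γ⁽ⁱ⁾ = 1`.** [cite: NesterenkoPhilippon2001, Ch. 3 Prop. 4.11 (pp. 40–41)] -/
theorem sum_v_mul_specPtU (h𝔭 : 𝔭.IsPrime)
    (hhom : 𝔭.IsHomogeneous (homogeneousSubmodule (Fin (m + 1)) ℚ))
    (hdim : ringKrullDim (Rx m ⧸ 𝔭) = (s + 1 : ℕ)) (hv : aChart 𝔭 s v ≠ 0) (i : Fin (ideg 𝔭 (s + 1))) :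
    ∑ k, algebraMap ℚ K (v k) * specPtU u v φ i k = 1 := by
  -- in `S`: `∑ v_k (a_v b⁽ⁱ⁾_k) = a_v`
  have h1 : ∑ k, algebraMap (RU s m) (HullU 𝔭 s v) (algebraMap ℚ (RU s m) (v k)) * hGenU 𝔭 s v i k =
      algebraMap (RU s m) (HullU 𝔭 s v) (aChart 𝔭 s v) := by
    apply Subtype.val_injective
    change ((HullU 𝔭 s v).val : HullU 𝔭 s v →+* ΩU s m) (∑ k, _ * hGenU 𝔭 s v i k) =
      algebraMap (RU s m) (ΩU s m) (aChart 𝔭 s v)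
    rw [map_sum]
    have : ∀ k, ((HullU 𝔭 s v).val : HullU 𝔭 s v →+* ΩU s m)
        (algebraMap (RU s m) (HullU 𝔭 s v) (algebraMap ℚ (RU s m) (v k)) * hGenU 𝔭 s v i k) =
        algebraMap (RU s m) (ΩU s m) (aChart 𝔭 s v) *
          (algebraMap ℚ (ΩU s m) (v k) * bChart 𝔭 s v i k) := fun k => by
      rw [map_mul]
      change algebraMap (RU s m) (ΩU s m) (algebraMap ℚ (RU s m) (v k)) *
        (algebraMap (RU s m) (ΩU s m) (aChart 𝔭 s v) * bChart 𝔭 s v i k) = _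
      rw [algebraMap_ΩU_ratCast]
      ring
    simp_rw [this]
    rw [← Finset.mul_sum, sum_v_mul_bChart h𝔭 hhom hdim hv, mul_one]
  have h2 := congrArg φ h1
  rw [map_sum, hφ] at h2
  have h3 : ∀ k, φ (algebraMap (RU s m) (HullU 𝔭 s v) (algebraMap ℚ (RU s m) (v k)) * hGenU 𝔭 s v i k) =
      aeval u (aChart 𝔭 s v) * (algebraMap ℚ K (v k) * specPtU u v φ i k) := fun k => by
    rw [map_mul, hφ, AlgHom.commutes, show φ (hGenU 𝔭 s v i k) =
      (fun k => φ (hGenU 𝔭 s v i k)) k from rfl, phi_hGenU_eq_smul hu]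
    simp only [Pi.smul_apply, smul_eq_mul]
    ring
  simp_rw [h3] at h2
  rw [← Finset.mul_sum] at h2
  exact mul_left_cancel₀ hu (h2.trans (mul_one _).symm)

omit hφ in
/-- **`γ⁽ⁱ⁾` is a zero of `𝔭`.** [cite: NesterenkoPhilippon2001, Ch. 3 Prop. 4.11 (pp. 40–41)] -/
theorem aeval_specPtU_eq_zero (h𝔭 : 𝔭.IsPrime)
    (hhom : 𝔭.IsHomogeneous (homogeneousSubmodule (Fin (m + 1)) ℚ))
    (hdim : ringKrullDim (Rx m ⧸ 𝔭) = (s + 1 : ℕ)) (i : Fin (ideg 𝔭 (s + 1))) {P : Rx m} (hP : P ∈ 𝔭) :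
    aeval (specPtU u v φ i) P = 0 := by
  have h1 : ∀ Q ∈ 𝔭, aeval (fun k => φ (hGenU 𝔭 s v i k)) Q = 0 := fun Q hQ => by
    rw [← ringHom_aevalHQ, aevalHQ_eq_zero h𝔭 hhom hdim v i hQ, map_zero]
  have h2 : specPtU u v φ i = (aeval u (aChart 𝔭 s v))⁻¹ • fun k => φ (hGenU 𝔭 s v i k) := by
    rw [phi_hGenU_eq_smul hu, smul_smul, inv_mul_cancel₀ hu, one_smul]
  rw [h2]
  exact NesterenkoK.aeval_smul_eq_zero_of_forall hhom h1 _ P hP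

omit hu in
/-- **`γ⁽ⁱ⁾` lies on the hyperplanes `u⁰₁, …, u⁰_s`.** [cite: NesterenkoPhilippon2001, Ch. 3 Prop. 4.11 (pp. 40–41)] -/
theorem sum_u_mul_specPtU (h𝔭 : 𝔭.IsPrime)
    (hhom : 𝔭.IsHomogeneous (homogeneousSubmodule (Fin (m + 1)) ℚ))
    (hdim : ringKrullDim (Rx m ⧸ 𝔭) = (s + 1 : ℕ)) (i : Fin (ideg 𝔭 (s + 1))) (i' : Fin s) :
    ∑ k : Fin (m + 1), u (i', k) * specPtU u v φ i k = 0 := by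
  have h1 : ∑ k : Fin (m + 1), u (i', k) * φ (hGenU 𝔭 s v i k) = 0 := by
    have := congrArg φ (sum_algebraMap_X_mul_hGenU h𝔭 hhom hdim v i i')
    rw [map_sum, map_zero] at this
    rw [← this]
    refine Finset.sum_congr rfl fun k _ => ?_
    rw [map_mul, hφ, aeval_X]
  have h2 : ∑ k : Fin (m + 1), u (i', k) * specPtU u v φ i k =
      (aeval u (aChart 𝔭 s v))⁻¹ * ∑ k : Fin (m + 1), u (i', k) * φ (hGenU 𝔭 s v i k) := by
    rw [Finset.mul_sum]
    refine Finset.sum_congr rfl fun k _ => ?_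
    rw [specPtU]
    ring
  rw [h2, h1, mul_zero]

/-- **`F(u⁰; w) = a_v(u⁰) ∏ᵢ (γ⁽ⁱ⁾ · w)` in `K[w]`.** [cite: NesterenkoPhilippon2001, Ch. 3 Prop. 4.4 (p. 38), Prop. 4.11 (pp. 40–41)] -/
theorem map_evU_splitLast (h𝔭 : 𝔭.IsPrime)
    (hhom : 𝔭.IsHomogeneous (homogeneousSubmodule (Fin (m + 1)) ℚ))
    (hdim : ringKrullDim (Rx m ⧸ 𝔭) = (s + 1 : ℕ)) (hv : aChart 𝔭 s v ≠ 0) (hD : 1 ≤ ideg 𝔭 (s + 1)) :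
    map (evU u) (splitLast s m (chowForm 𝔭 (s + 1))) =
      C (aeval u (aChart 𝔭 s v)) * ∏ i : Fin (ideg 𝔭 (s + 1)), (∑ k, C (specPtU u v φ i k) * X k) := by
  have hcomp : φ.comp (algebraMap (RU s m) (HullU 𝔭 s v)) = evU u := RingHom.ext hφ
  have h := congrArg (map φ) (gHullU_identity h𝔭 hhom hdim hv hD)
  rw [map_mul, map_C, map_pow, hφ, C_pow, gHullU, map_map, hcomp, map_prod] at h
  have h2 : ∀ i : Fin (ideg 𝔭 (s + 1)),
      map φ (∑ k, C (hGenU 𝔭 s v i k) * X k) = C (aeval u (aChart 𝔭 s v)) * (∑ k, C (specPtU u v φ i k) * X k) :=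
    fun i => by
    rw [← linK_smul, ← phi_hGenU_eq_smul hu]
    simp only [map_sum, map_mul, map_C, map_X]
  simp_rw [h2] at h
  rw [Finset.prod_mul_distrib, Finset.prod_const, Finset.card_univ, Fintype.card_fin] at h
  have hpow : (C (aeval u (aChart 𝔭 s v)) : MvPolynomial (Fin (m + 1)) K) ^ ideg 𝔭 (s + 1) =
      C (aeval u (aChart 𝔭 s v)) ^ (ideg 𝔭 (s + 1) - 1) * C (aeval u (aChart 𝔭 s v)) := by
    rw [← pow_succ, Nat.sub_add_cancel hD]
  rw [hpow, mul_assoc] at h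
  have hne : (C (aeval u (aChart 𝔭 s v)) : MvPolynomial (Fin (m + 1)) K) ^ (ideg 𝔭 (s + 1) - 1) ≠ 0 :=
    pow_ne_zero _ (by rw [Ne, C_eq_zero]; exact hu)
  exact mul_left_cancel₀ hne h

/-- **`G(u⁰) = a_v(u⁰)^d ∏ᵢ Q₀(γ⁽ⁱ⁾)`.** [cite: NesterenkoPhilippon2001, Ch. 3 Prop. 4.11 (pp. 40–41)] -/
theorem aeval_uResultant_eq (h𝔭 : 𝔭.IsPrime)
    (hhom : 𝔭.IsHomogeneous (homogeneousSubmodule (Fin (m + 1)) ℚ))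
    (hdim : ringKrullDim (Rx m ⧸ 𝔭) = (s + 1 : ℕ)) {d : ℕ} {Q₀ : MvPolynomial (Fin (m + 1)) ℤ}
    (hQ : Q₀.IsHomogeneous d) (hv : aChart 𝔭 s v ≠ 0) (hD : 1 ≤ ideg 𝔭 (s + 1)) :
    aeval u (uResultant 𝔭 s d Q₀) =
      aeval u (aChart 𝔭 s v) ^ d * ∏ i : Fin (ideg 𝔭 (s + 1)), aeval (specPtU u v φ i) Q₀ := by
  have h := congrArg φ (uResultant_identity h𝔭 hhom hdim hQ hv hD)
  rw [hφ, map_mul φ, map_pow φ, map_prod φ, hφ, map_mul, map_pow] at h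
  have h2 : ∀ i : Fin (ideg 𝔭 (s + 1)),
      φ (aevalHZ 𝔭 s v i Q₀) = aeval u (aChart 𝔭 s v) ^ d * aeval (specPtU u v φ i) Q₀ := fun i => by
    rw [ringHom_aevalHZ, phi_hGenU_eq_smul hu, aeval_smul_of_isHomogeneous_int hQ]
  simp_rw [h2] at h
  rw [Finset.prod_mul_distrib, Finset.prod_const, Finset.card_univ, Fintype.card_fin, ← pow_mul] at h
  refine mul_left_cancel₀ (pow_ne_zero (d * ideg 𝔭 (s + 1)) hu) ?_
  rw [h]
  ring

end Pointwise

/-- **Pointwise product formula for the `u`-resultant** (packaged). Let `K` be an algebraically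
closed field of characteristic `0`, `u⁰ ∈ K^{s(m+1)}` and `v ∈ ℚ^{m+1}` a rational chart with
`a_v(u⁰) = F(u⁰; v) ≠ 0`. Then there are points `γ⁽ⁱ⁾ ∈ K^{m+1}`, `i < D`, with `v · γ⁽ⁱ⁾ = 1`, zeros
of `𝔭` on the hyperplanes `u⁰₁, …, u⁰_s`, such that `F(u⁰; w) = a_v(u⁰) ∏ (γ⁽ⁱ⁾ · w)` and
`G(u⁰) = a_v(u⁰)^d ∏ Q₀(γ⁽ⁱ⁾)` for every integer form `Q₀` of degree `d`.
[cite: NesterenkoPhilippon2001, Ch. 3 Prop. 4.11 (pp. 40–41)] -/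
theorem exists_pointwise_uResultant {K : Type*} [Field K] [IsAlgClosed K] [Algebra ℚ K]
    (h𝔭 : 𝔭.IsPrime) (hhom : 𝔭.IsHomogeneous (homogeneousSubmodule (Fin (m + 1)) ℚ))
    (hdim : ringKrullDim (Rx m ⧸ 𝔭) = (s + 1 : ℕ)) (hD : 1 ≤ ideg 𝔭 (s + 1))
    {d : ℕ} {Q₀ : MvPolynomial (Fin (m + 1)) ℤ} (hQ : Q₀.IsHomogeneous d)
    (u : Fin s × Fin (m + 1) → K) {v : Fin (m + 1) → ℚ} (hu : aeval u (aChart 𝔭 s v) ≠ 0) :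
    ∃ γ : Fin (ideg 𝔭 (s + 1)) → Fin (m + 1) → K,
      (∀ i, ∑ k, algebraMap ℚ K (v k) * γ i k = 1) ∧
      (∀ i, ∀ P ∈ 𝔭, aeval (γ i) P = 0) ∧
      (∀ i (i' : Fin s), ∑ k : Fin (m + 1), u (i', k) * γ i k = 0) ∧
      map (evU u) (splitLast s m (chowForm 𝔭 (s + 1))) =
        C (aeval u (aChart 𝔭 s v)) * ∏ i, (∑ k, C (γ i k) * X k) ∧
      aeval u (uResultant 𝔭 s d Q₀) = aeval u (aChart 𝔭 s v) ^ d * ∏ i, aeval (γ i) Q₀ := by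
  have hv : aChart 𝔭 s v ≠ 0 := fun h => hu (by rw [h, map_zero])
  obtain ⟨φ, hφ⟩ := exists_specializationU h𝔭 hhom hdim hv u
  exact ⟨specPtU u v φ, fun i => sum_v_mul_specPtU hφ hu h𝔭 hhom hdim hv i,
    fun i _ hP => aeval_specPtU_eq_zero hu h𝔭 hhom hdim i hP,
    fun i i' => sum_u_mul_specPtU hφ h𝔭 hhom hdim i i', map_evU_splitLast hφ hu h𝔭 hhom hdim hv hD,
    aeval_uResultant_eq hφ hu h𝔭 hhom hdim hQ hv hD⟩

/-- **A good rational chart exists as soon as `F(u⁰; ·) ≠ 0`.** [folklore] -/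
theorem exists_aChart_ne_zero {K : Type*} [Field K] [Algebra ℚ K] (u : Fin s × Fin (m + 1) → K)
    (h : map (evU u) (splitLast s m (chowForm 𝔭 (s + 1))) ≠ 0) :
    ∃ v : Fin (m + 1) → ℚ, aeval u (aChart 𝔭 s v) ≠ 0 := by
  obtain ⟨v, hv⟩ := exists_rat_eval_ne_zero h
  refine ⟨v, ?_⟩
  have : aeval u (aChart 𝔭 s v) = eval (fun k => algebraMap ℚ K (v k)) (map (evU u) (splitLast s m (chowForm 𝔭 (s + 1)))) := by
    rw [aChart, eval_map, show (eval fun k => algebraMap ℚ (RU s m) (v k)) =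
      eval₂Hom (RingHom.id _) (fun k => algebraMap ℚ (RU s m) (v k)) from rfl, coe_eval₂Hom,
      ← evU_apply, eval₂_comp_left, RingHom.comp_id]
    congr 1
    funext k
    rw [Function.comp_apply, evU_apply, AlgHom.commutes]
  rwa [this]

end Prime

end Nesterenko

end Literature.NumberTheory.Transcendental

end
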